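import Summits.NavierStokesRegularity.FluidComputer.GateBudgetPulseWindow
import HarnessLib

/-!
# What no tuning can beat, part 19: THE LEVELS OF THE DUD LATTICE — the constants of the
# two-scale family fixed; the hypothesis list of `knob_lattice_dud` read off the dynamics

Cell `pub-fluidc`, blueprint seat bp1 (gen 29, second item, with part 18); same namespace and
conventions as parts 1–18 (`GateBudget*.lean`); imports part 18 (`GateBudgetPulseWindow`: entry
levels at the critical time, the clock window and the pulse window with typed hitting times).
Modes `0 = a` input, `1 = b` clock, `2 = c` catalyst (`u = c/ρ²`), `3 = d` transfer, `4 = ã`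
output; `σ_knob = ρ²/ε`. HONEST FRAMING (verbatim): low prior, high value-of-information
experiment on Tao's machine paradigm; NOT a claim that NS blows up. Nothing is proved about the
Navier–Stokes equations.

## What this part records (SPEC-INPUT-bp1 §X item (1), the numbers)

* §56 `knob_dynamic_levels`: part 18 with the constants of the two-scale family FIXED — horizon
  `H = 1/16`, surrender level `β = ε/4`, armed radius `ϱ = 7ε/10`, transit level `γ = 13ε/20`,
  entry = exit catalyst level `λ₁ = λ = K⁻¹⁰` — under the POLYNOMIAL trigger hypotheses of gen 22
  (`16 ≤ K`, `48 log K ≤ M ≤ K¹⁰`, `ε² ≤ 1/(6K²⁰)`, `0 < ρ² ≤ ε`, `Mρ⁴ ≤ ε²`: the whole dud-lattice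
  range `σ_knob M ≤ 2`, no exponential scale separation) and ONE largeness hypothesis on the
  amplifier, `(8/M)log(25εK¹⁰/(8ρ²)) + 200/(169M - 400) < 1/16` (i.e. `M ≳ 2⁷ log(3K¹⁰/σ_knob)`;
  ample at Tao's `M = K¹⁰`): every member has times `1 ≤ s₀ ≤ 3/2 < 2`, `s₀ < T`,
  `T - s₀ ≤ (8/M)log(25εK¹⁰/(8ρ²)) + 200/(169M - 400) < 1/16`, with the catalyst lit and the pair
  armed `b² + c² ≥ (7ε/10)²` on `[s₀,T]`, `b(s₀) ≥ ε/2`, `c(s₀) = ρ²/K¹⁰`, `b(T) ≤ -ε/4`,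
  `c(T) ≤ (K⁻¹⁰ + 4e^{-M}/M)ρ²`, pre-entry dose `|(C(s₀) - C(0))/ρ²| ≤ 3/(2K¹⁰)` for ANY primitive
  `C` of the catalyst, `ã(s₀) ≤ 3/K¹⁰`, `ã(T) ≤ ã(s₀) + K(T - s₀)`, `|a(s₀) - 1| ≤ 8/K²⁰`,
  `|d(s₀)| ≤ 3/K¹⁰` — the hypothesis list of part 17's `knob_lattice_dud` with `b₁ = ε/2`,
  `γ₁ = ρ²/K¹⁰`, `β = ε/4`, `ϱ = 7ε/10` (`q = ε²/(Mϱ²) = 100/(49M)`), `λ₀ = K⁻¹⁰ + 4e^{-M}/M`,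
  `φ₀ = 3/(2K¹⁰)`, and for the drift `ã(T) ≤ 3/K¹⁰ + K/16`.

READING. With the numbers in, the only free inputs left for the S13″ dichotomy on the lattice
`ε = kMρ²` are `K`, `M` and the lattice index `k`: in part 17's `knob_lattice_dud` the clock
budget is `Mβ/ε = M/4`, `q = 100/(49M)`, `η = arctan(2/(kMK¹⁰)) + arctan(4(K⁻¹⁰ + 4e^{-M}/M)/(kM))`,
`D₀ = 10e^{-M}(T - s₀)/(7kM)`, `φ₀ = 3/(2K¹⁰)`, so `ψ = k(η + (πq + D₀)/(1 - q)) + φ₀` is of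
order `k/M`. What remains (successor): the assembly `knob_lattice_dud ∘ knob_dynamic_levels`
and the choice of `k`.

HONEST LIMITS. As part 18: one exact trajectory from (5.6); the largeness hypothesis on `M` is NOT
discharged for small `M`; `ã(T) ≤ ã(s₀) + K(T - s₀)` only (so part 16's drift wants
`M ≫ K log(K/σ_knob)`); no second pulse excluded after `s₀ + 1/16`; nothing about the cascade or
Navier–Stokes; `0` named facts, `0` sorry.
[cite: Tao2016AveragedNS, §5.5 Theorem 5.3, (5.5), (5.6), (b-eq), (c-eq), (tcable)]
-/

noncomputable section

namespace Summit.NavierStokesRegularity.FluidComputer.GateBudget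

open Real Set Filter Topology
open Literature.Analysis.FluidPDE.Tao2016AveragedNS

variable {K M ε ρ : ℝ} {X : ℝ → Fin 5 → ℝ} {C : ℝ → ℝ}

/-! ## §56 The levels of the dud lattice: the constants of the two-scale family fixed -/

/-- **THE LEVELS FROM THE DYNAMICS, knob family (constants fixed).** Along `rotorCircuit K M ε ρ`
from (5.6) under the polynomial trigger hypotheses (`16 ≤ K`, `48 log K ≤ M ≤ K¹⁰`,
`ε² ≤ 1/(6K²⁰)`, `0 < ρ² ≤ ε`, `Mρ⁴ ≤ ε²`) and the ONE largeness hypothesis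
`(8/M)log(25εK¹⁰/(8ρ²)) + 200/(169M - 400) < 1/16` on the amplifier: with `H = 1/16`, `β = ε/4`,
`ϱ = 7ε/10`, `γ = 13ε/20`, `λ₁ = λ = K⁻¹⁰` in part 18 there are times `1 ≤ s₀ ≤ 3/2`, `s₀ < T`,
`T - s₀ ≤ (8/M)log(25εK¹⁰/(8ρ²)) + 200/(169M - 400)` carrying EVERY level hypothesis of part 17's
`knob_lattice_dud`: catalyst lit and `b² + c² ≥ (7ε/10)²` on `[s₀,T]`, `b(s₀) ≥ ε/2`,
`c(s₀) = ρ²/K¹⁰`, `b(T) ≤ -ε/4`, `c(T) ≤ (K⁻¹⁰ + 4e^{-M}/M)ρ²`, `|(C(s₀) - C(0))/ρ²| ≤ 3/(2K¹⁰)`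
for any primitive `C` of the catalyst, `ã(s₀) ≤ 3/K¹⁰`, `ã(T) ≤ ã(s₀) + K(T - s₀)`,
`|a(s₀) - 1| ≤ 8/K²⁰`, `|d(s₀)| ≤ 3/K¹⁰`.
[cite: Tao2016AveragedNS, §5.5 Theorem 5.3, (5.5), (5.6), (b-eq), (c-eq), (tcable)] -/
theorem knob_dynamic_levels (hX : ∀ t, HasDerivAt X (RotorKnob.rotorCircuit K M ε ρ (X t)) t)
    (h0 : X 0 = delayInit) (hε : 0 < ε) (hρ : 0 < ρ) (hρε : ρ ^ 2 ≤ ε) (hM : 0 < M)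
    (hMK : M ≤ K ^ 10) (hK : 16 ≤ K) (hML : 48 * Real.log K ≤ M)
    (hεK : ε ^ 2 ≤ 1 / (6 * K ^ 20)) (hMρ : M * ρ ^ 4 ≤ ε ^ 2)
    (hC : ∀ t, HasDerivAt C (X t 2) t)
    (hbig : 8 * log (25 * ε * K ^ 10 / (8 * ρ ^ 2)) / M + 200 / (169 * M - 400) < 1 / 16) :
    ∃ s₀ T : ℝ, 1 ≤ s₀ ∧ s₀ ≤ 3 / 2 ∧ s₀ < T ∧
      T - s₀ ≤ 8 * log (25 * ε * K ^ 10 / (8 * ρ ^ 2)) / M + 200 / (169 * M - 400) ∧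
      (∀ t ∈ Icc s₀ T, 0 < X t 2) ∧
      (∀ t ∈ Icc s₀ T, (7 / 10 * ε) ^ 2 ≤ X t 1 ^ 2 + X t 2 ^ 2) ∧
      ε / 2 ≤ X s₀ 1 ∧ X s₀ 2 = ρ ^ 2 / K ^ 10 ∧ X T 1 ≤ -(ε / 4) ∧
      X T 2 ≤ (1 / K ^ 10 + 4 * exp (-M) / M) * ρ ^ 2 ∧
      |(C s₀ - C 0) / ρ ^ 2| ≤ 3 / (2 * K ^ 10) ∧ X s₀ 4 ≤ 3 / K ^ 10 ∧
      X T 4 ≤ X s₀ 4 + K * (T - s₀) ∧ |X s₀ 0 - 1| ≤ 8 / K ^ 20 ∧ |X s₀ 3| ≤ 3 / K ^ 10 := by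
  have hK0 : 0 < K := by linarith
  have hK10 : 0 < K ^ 10 := by positivity
  have hρ2 : 0 < ρ ^ 2 := by positivity
  have hε2 : 0 < ε ^ 2 := by positivity
  -- `M ≥ 133` from `M ≥ 48 log K ≥ 48 log 16 = 192 log 2`
  have hM133 : 133 ≤ M := by
    have h16 : log 16 = 4 * log 2 := by
      rw [show (16 : ℝ) = 2 ^ 4 by norm_num, Real.log_pow]; norm_num
    have hlogK : log 16 ≤ log K := log_le_log (by norm_num) hK
    linarith [Real.log_two_gt_d9]
  have hMε : 133 * ε ^ 2 ≤ M * ε ^ 2 := mul_le_mul_of_nonneg_right hM133 hε2.le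
  -- §54: entry at the critical time
  obtain ⟨s₀, hs₁, hs32, hcle, hcs₀, hbs₀, has₀, hde⟩ :=
    knob_entry_levels hX h0 hε hρ hρε hM hMK hK hML hεK hMρ
  have hs₀ : 0 ≤ s₀ := by linarith
  have hK20 : (1700 : ℝ) ≤ K ^ 20 := le_trans (by norm_num) (pow_le_pow_left₀ (by norm_num) hK 20)
  have h17 : 17 * ε / K ^ 20 ≤ ε / 100 := by
    rw [div_le_div_iff₀ (by positivity) (by norm_num)]
    have := mul_le_mul_of_nonneg_left hK20 hε.le
    linarith
  have hb99 : 99 / 100 * ε ≤ X s₀ 1 := by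
    have h := (abs_le.1 hbs₀).1
    have h1 := mul_le_mul_of_nonneg_right h17 hs₀
    have h2 := mul_le_mul_of_nonneg_left hs₁ hε.le
    linarith
  -- §55 with `H = 1/16`, `β = ε/4`, `ϱ = 7ε/10`, `γ = 13ε/20`, `λ₁ = λ = K⁻¹⁰`
  have hγε : ε ^ 2 < M * (13 / 20 * ε) ^ 2 := by
    rw [show M * (13 / 20 * ε) ^ 2 = 169 / 400 * (M * ε ^ 2) by ring]; linarith
  have hγϱ : (13 / 20 * ε) ^ 2 + (ε / 4) ^ 2 ≤ (7 / 10 * ε) ^ 2 := by linarith [hε2]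
  have harm : (7 / 10 * ε) ^ 2 + 2 * ε ^ 2 * ((s₀ + 1 / 16) ^ 2 - s₀ ^ 2) ≤
      X s₀ 1 ^ 2 + X s₀ 2 ^ 2 := by
    have hb2 : (99 / 100 * ε) * (99 / 100 * ε) ≤ X s₀ 1 * X s₀ 1 :=
      mul_self_le_mul_self (by positivity) hb99
    have hs : ε ^ 2 * s₀ ≤ ε ^ 2 * (3 / 2) := mul_le_mul_of_nonneg_left hs32 hε2.le
    linarith [sq_nonneg (X s₀ 2), hb2, hs]
  have hu₁ : 1 / K ^ 10 * ρ ^ 2 ≤ X s₀ 2 := by rw [hcs₀]; apply le_of_eq; ring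
  have hden : 0 < M * (13 / 20 * ε) ^ 2 - ε ^ 2 := by
    rw [show M * (13 / 20 * ε) ^ 2 - ε ^ 2 = 169 / 400 * (M * ε ^ 2) - ε ^ 2 by ring]; linarith
  have hΔB : 2 * ε * (ε / 4) / (M * (13 / 20 * ε) ^ 2 - ε ^ 2) = 200 / (169 * M - 400) := by
    rw [div_eq_div_iff hden.ne' (by linarith : (0:ℝ) < 169 * M - 400).ne']
    ring
  have hx : 2 * ε * (s₀ + 1 / 16) / (1 / K ^ 10 * ρ ^ 2) ≤ 25 * ε * K ^ 10 / (8 * ρ ^ 2) := by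
    rw [show 2 * ε * (s₀ + 1 / 16) / (1 / K ^ 10 * ρ ^ 2)
        = 2 * (s₀ + 1 / 16) * (ε * K ^ 10 / ρ ^ 2) by field_simp,
      show 25 * ε * K ^ 10 / (8 * ρ ^ 2) = 25 / 8 * (ε * K ^ 10 / ρ ^ 2) by ring]
    exact mul_le_mul_of_nonneg_right (by linarith) (by positivity)
  have hlog := log_le_log (by positivity) hx
  have hid : ε * log (2 * ε * (s₀ + 1 / 16) / (1 / K ^ 10 * ρ ^ 2)) / (M * (ε / 4))
      = 4 * (log (2 * ε * (s₀ + 1 / 16) / (1 / K ^ 10 * ρ ^ 2)) / M) := by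
    field_simp
  have h8 : 8 * (log (2 * ε * (s₀ + 1 / 16) / (1 / K ^ 10 * ρ ^ 2)) / M)
      ≤ 8 * (log (25 * ε * K ^ 10 / (8 * ρ ^ 2)) / M) :=
    mul_le_mul_of_nonneg_left (div_le_div_of_nonneg_right hlog hM.le) (by norm_num)
  rw [mul_div_assoc] at hbig
  have hΔ : ε * log (2 * ε * (s₀ + 1 / 16) / (1 / K ^ 10 * ρ ^ 2)) / (M * (ε / 4))
      + 2 * ε * (ε / 4) / (M * (13 / 20 * ε) ^ 2 - ε ^ 2)
      + ε * log (2 * ε * (s₀ + 1 / 16) / (1 / K ^ 10 * ρ ^ 2)) / (M * (ε / 4)) < 1 / 16 := by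
    rw [hΔB, hid]; linarith
  obtain ⟨t₁, t₂, T, h01, h12, h2T, hTΔ, hTH, -, -, -, -, hdead, hcT, harmw, hcpos⟩ :=
    knob_pulse_window hX h0 hε hρ hρε hM hs₀ (by norm_num : (0:ℝ) < 1 / 16) (by positivity)
      (by linarith) (by positivity) hγϱ hγε harm hu₁ (by positivity) le_rfl hΔ
  have hsT : s₀ < T := by linarith
  -- the dose, the output and the exit levels
  have hdose := knob_entry_dose hX h0 hρ hC hs₀ (ℓ := 1 / K ^ 10)
    (fun t ht => by rw [show 1 / K ^ 10 * ρ ^ 2 = ρ ^ 2 / K ^ 10 by ring]; exact hcle t ht)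
  have hgrow := knob_output_growth hX h0 hK0.le hsT.le
  have hcT' : X T 2 ≤ (1 / K ^ 10 + 4 * exp (-M) / M) * ρ ^ 2 := by
    rw [show ε * exp (-M) / (M * (ε / 4)) = 4 * exp (-M) / M by
      rw [div_eq_div_iff (by positivity) hM.ne']; ring] at hcT
    exact hcT
  have hΦ₀ : |(C s₀ - C 0) / ρ ^ 2| ≤ 3 / (2 * K ^ 10) := by
    refine hdose.2.trans ?_
    rw [div_mul_eq_mul_div, one_mul, div_le_div_iff₀ hK10 (by positivity)]
    have := mul_le_mul_of_nonneg_right hs32 hK10.le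
    linarith
  refine ⟨s₀, T, hs₁, hs32, hsT, ?_, fun t ht => hcpos t ⟨ht.1, by linarith [ht.2]⟩,
    fun t ht => harmw t ⟨ht.1, by linarith [ht.2]⟩, by linarith, hcs₀,
    hdead T ⟨h2T, hTH.le⟩, hcT', hΦ₀, (abs_le.1 (hde s₀ ⟨hs₀, le_rfl⟩).2).2, hgrow, has₀,
    (hde s₀ ⟨hs₀, le_rfl⟩).1⟩
  rw [hΔB, hid] at hTΔ
  rw [mul_div_assoc]
  linarith

end Summit.NavierStokesRegularity.FluidComputer.GateBudget
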